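import Literature.Probability.RandomPlanarGeometry.SLERestrictionLemmas
import Literature.Probability.RandomPlanarGeometry.SLETraceEightKernel
import Literature.Probability.RandomPlanarGeometry.LoewnerInverse
import Literature.Probability.RandomPlanarGeometry.LoewnerGrowth
import Literature.Probability.RandomPlanarGeometry.LoewnerMapProofs
import Literature.Probability.RandomPlanarGeometry.LoewnerTransformContinuity
import Literature.Probability.RandomPlanarGeometry.CaratheodoryHalfPlaneProofs
import Mathlib.Analysis.Convex.PathConnected
import Mathlib.Topology.Order.IntermediateValue
import HarnessLib

/-!
# `stub_flank` — the deterministic FLANK LEMMA (crux `PathUpgradeR`, stmt-CriticalPhenomena-18055,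
line `bidir_windows`)

A Loewner chain `(U, ζ)` with simple trace is seen in a Dobrushin domain `E` through the boundary
extension `ψ̄` of a uniformizer `ψ : ℍ → E`; a reference curve `r = ψ̄ ∘ ρ` `ε`-shadows every
initial segment `X[0, t] = ψ̄ (ζ [0, t])`, with injectivity moduli (`inj`, `inj₀`), small driver
oscillation on short capacity windows (`osc`), a conformally far gate point (`Ma`), conformally far
points off `r ∪ ∂E` (`Mb`), interior balls (`bd`) and a gate decomposition
`ψ (H_{t₁}) = P ⊔ Q ⊔ C` at every `t₁ ≤ T` (`gate`). **Theorem.** A `c₀`-sub-front point `X t` is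
flanked by its past along every short segment towards a far point `e`. **Proof.** (1) *Record*
`(t₁, M)` = maximal witness level over `X[0, t]`: `t₁ ≤ M < t₁ + w`, `t₁ < t`; (2) *overshoot*
`t₂` = first time `≥ t` with a witness at level `≥ M + θ`: `t₂ ≤ M + θ + 2w`
(`exists_record_overshoot`); (3) *pocket*: for `t₁ < s ≤ t₂`, `g_{t₁}(ζ s)` lies in the hull of
the shifted chain, within `ρ₁ + 4√(t₂ - t₁) ≤ r₁` of `U t₁` (Lawler (2005), Lemma 4.13 and
Rem. 4.9: `hull_subset_closedBall_driving`, `mem_hull_iff_map_mem_hull`), so `X s ∈ P`; (4) *gate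
at the front*: the connected tube of `3ε`-balls about `r [M + θ/2, M + 5θ]` misses `X[0, t₁]`,
lies in `ψ (H_{t₁})`, meets `P` at `X t₂` and `Q` at the gate point, hence meets `C`, pinning `C`
(diameter `≤ λ`) near levels `≥ M + θ/2`; (5) *transversal*: the segment from `X t ∈ P` to `e ∈ Q`
lies in `E`, misses `C` (`inj₀`), is connected, so it leaves `ψ (H_{t₁})`, i.e. meets
`ψ (K_{t₁}) = X(0, t₁]`. [folklore]
-/

noncomputable section

open Set Filter Metric Topology Bornology
open scoped NNReal
open UpperHalfPlane (upperHalfPlaneSet isOpen_upperHalfPlaneSet)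

namespace Summit.CriticalPhenomena.SAWScalingLimit.Theorems

open Literature.Probability.RandomPlanarGeometry Literature.Probability.RandomPlanarGeometry.Loewner

namespace PathUpgradeRFlank

/-- Hausdorff shadowing is honest between compact nonempty sets. [folklore] -/
theorem exists_dist_le_of_hausdorffDist_le {A B : Set ℂ} (hA : IsCompact A) (hB : IsCompact B)
    (hAne : A.Nonempty) (hBne : B.Nonempty) {δ : ℝ} (h : hausdorffDist A B ≤ δ) {x : ℂ}
    (hx : x ∈ A) : ∃ y ∈ B, dist x y ≤ δ := by
  obtain ⟨y, hy, hyeq⟩ := hB.exists_infDist_eq_dist hBne x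
  exact ⟨y, hy, hyeq ▸ (infDist_le_hausdorffDist_of_mem hx
    (hausdorffEDist_ne_top_of_nonempty_of_bounded hAne hBne hA.isBounded hB.isBounded)).trans h⟩

/-- Forward shadowing: every point of `X[0, t']` is `ε`-close to a point of `r[0, t']`.
[folklore] -/
theorem exists_fwd_witness {X r : ℝ≥0 → ℂ} (hX : Continuous X) (hr : Continuous r) {t' : ℝ≥0}
    {ε : ℝ} (h : hausdorffDist (X '' Icc 0 t') (r '' Icc 0 t') ≤ ε) {s : ℝ≥0} (hs : s ≤ t') :
    ∃ u : ℝ≥0, u ≤ t' ∧ dist (X s) (r u) ≤ ε := by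
  obtain ⟨y, ⟨u, hu, rfl⟩, hy⟩ := exists_dist_le_of_hausdorffDist_le (isCompact_Icc.image hX)
    (isCompact_Icc.image hr) ((nonempty_Icc.2 zero_le).image X)
    ((nonempty_Icc.2 zero_le).image r) h (mem_image_of_mem X ⟨zero_le, hs⟩)
  exact ⟨u, hu.2, hy⟩

/-- Backward shadowing: every point of `r[0, t']` is `ε`-close to a point of `X[0, t']`.
[folklore] -/
theorem exists_bwd_witness {X r : ℝ≥0 → ℂ} (hX : Continuous X) (hr : Continuous r) {t' : ℝ≥0}
    {ε : ℝ} (h : hausdorffDist (X '' Icc 0 t') (r '' Icc 0 t') ≤ ε) {u : ℝ≥0} (hu : u ≤ t') :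
    ∃ s : ℝ≥0, s ≤ t' ∧ dist (X s) (r u) ≤ ε := by
  rw [hausdorffDist_comm] at h
  obtain ⟨y, ⟨s, hs, rfl⟩, hy⟩ := exists_dist_le_of_hausdorffDist_le (isCompact_Icc.image hr)
    (isCompact_Icc.image hX) ((nonempty_Icc.2 zero_le).image r)
    ((nonempty_Icc.2 zero_le).image X) h (mem_image_of_mem r ⟨zero_le, hu⟩)
  exact ⟨s, hs.2, by rwa [dist_comm] at hy⟩

/-- Witness comparison: under the injectivity modulus of `r`, two `r`-witnesses of two nearby
points have times closer than `w`. [folklore] -/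
theorem abs_sub_lt_of_witness {r : ℝ≥0 → ℂ} {T : ℝ≥0} {w μ : ℝ}
    (hinj : ∀ s t : ℝ≥0, (s : ℝ) ≤ T + 1 → (t : ℝ) ≤ T + 1 → w ≤ |(s : ℝ) - t| →
      μ ≤ dist (r s) (r t))
    {u u' : ℝ≥0} (hu : (u : ℝ) ≤ T + 1) (hu' : (u' : ℝ) ≤ T + 1) {y y' : ℂ} {R R' δ : ℝ}
    (hy : dist y (r u) ≤ R) (hy' : dist y' (r u') ≤ R') (hyy' : dist y y' ≤ δ)
    (hμ : R + R' + δ < μ) : |(u : ℝ) - u'| < w := by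
  by_contra hle
  have h := hinj u u' hu hu' (not_lt.1 hle)
  have h' : dist (r u) (r u') ≤ R + δ + R' := (dist_triangle4 (r u) y y' (r u')).trans
    (add_le_add_three (by rwa [dist_comm]) hyy' hy')
  linarith

/-- **Record and overshoot.** For a `c₀`-sub-front point `X t` (a point with an `r`-witness `ut`
lying `c₀` below the witness level `us` of an earlier point), the record pair `(t₁, M)` (maximal
witness level `M` over `X[0, t]`, attained at time `t₁`) and the overshoot pair `(t₂, u₂)` (first
time `t₂ ≥ t` with a witness `u₂ ≥ M + θ`) satisfy `t₁ < t ≤ t₂`, `t₁ ≤ M < t₁ + w`,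
`t₂ ≤ M + θ + 2w`, `M + θ ≤ u₂ < t₂ + w`. [folklore] -/
theorem exists_record_overshoot {X r : ℝ≥0 → ℂ} (hX : Continuous X) (hr : Continuous r)
    {T : ℝ≥0} {ε μ w θ c₀ : ℝ} (hε : 0 < ε) (hεμ : 5 * ε < μ) (hw : 0 < w) (hwθ : w < θ / 2)
    (hθc : 8 * θ < c₀) (hθ1 : 5 * θ + w ≤ 1)
    (hsh : ∀ t' : ℝ≥0, (t' : ℝ) ≤ T + 1 → hausdorffDist (X '' Icc 0 t') (r '' Icc 0 t') ≤ ε)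
    (hinj : ∀ s t : ℝ≥0, (s : ℝ) ≤ T + 1 → (t : ℝ) ≤ T + 1 → w ≤ |(s : ℝ) - t| →
      μ ≤ dist (r s) (r t))
    {t ut : ℝ≥0} (ht : (t : ℝ) ≤ T) (hut : (ut : ℝ) ≤ T + 1) (hXt : dist (X t) (r ut) ≤ 2 * ε)
    (hsub : ∃ s : ℝ≥0, s ≤ t ∧ ∃ us : ℝ≥0, (us : ℝ) ≤ T + 1 ∧ dist (X s) (r us) ≤ 2 * ε ∧
      (ut : ℝ) + c₀ ≤ us) :
    ∃ t₁ M t₂ u₂ : ℝ≥0, t₁ < t ∧ t ≤ t₂ ∧ (t₁ : ℝ) ≤ M ∧ (M : ℝ) < t₁ + w ∧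
      (t₂ : ℝ) ≤ M + θ + 2 * w ∧ (ut : ℝ) + c₀ ≤ M ∧ (M : ℝ) + θ ≤ u₂ ∧ (u₂ : ℝ) < t₂ + w ∧
      (u₂ : ℝ) ≤ T + 1 ∧ dist (X t₂) (r u₂) ≤ 2 * ε := by
  obtain ⟨s₀, hs₀, us, hus, hdus, hc₀us⟩ := hsub
  have hθ : 0 < θ := by linarith
  -- (1) RECORD: maximise the witness level over `X[0, t]`
  set K : Set (ℝ≥0 × ℝ≥0) :=
    {p | p.1 ≤ t ∧ (p.2 : ℝ) ≤ T + 1 ∧ dist (X p.1) (r p.2) ≤ 2 * ε} with hK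
  have hKc : IsCompact K := by
    refine ((isCompact_Icc (a := (0 : ℝ≥0)) (b := t)).prod
      (isCompact_Icc (a := (0 : ℝ≥0)) (b := T + 1))).of_isClosed_subset ?_ ?_
    · exact (isClosed_le continuous_fst continuous_const).inter
        ((isClosed_le (continuous_subtype_val.comp continuous_snd) continuous_const).inter
        (isClosed_le ((hX.comp continuous_fst).dist (hr.comp continuous_snd)) continuous_const))
    · rintro ⟨a, b⟩ ⟨ha, hb, -⟩
      exact ⟨⟨zero_le, ha⟩, zero_le, by exact_mod_cast hb⟩
  obtain ⟨⟨t₁, M⟩, ⟨ht₁t, hMT, hdM⟩, hmax⟩ :=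
    hKc.exists_isMaxOn ⟨(s₀, us), hs₀, hus, hdus⟩ continuous_snd.continuousOn
  have hrec : ∀ s u : ℝ≥0, s ≤ t → (u : ℝ) ≤ T + 1 → dist (X s) (r u) ≤ 2 * ε → u ≤ M :=
    fun s u hs hu hd ↦ isMaxOn_iff.1 hmax (s, u) ⟨hs, hu, hd⟩
  have hMc₀ : (ut : ℝ) + c₀ ≤ M := hc₀us.trans (NNReal.coe_le_coe.2 (hrec s₀ us hs₀ hus hdus))
  have ht₁t' : (t₁ : ℝ) ≤ t := NNReal.coe_le_coe.2 ht₁t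
  have ht₁T : (t₁ : ℝ) ≤ T + 1 := by linarith
  have ht₁M : (t₁ : ℝ) ≤ M := by
    obtain ⟨s', hs', hd⟩ := exists_bwd_witness hX hr (hsh t₁ ht₁T) le_rfl
    exact NNReal.coe_le_coe.2 (hrec s' t₁ (hs'.trans ht₁t) ht₁T (hd.trans (by linarith)))
  have hMt₁ : (M : ℝ) < t₁ + w := by
    obtain ⟨u', hu', hd⟩ := exists_fwd_witness hX hr (hsh t₁ ht₁T) le_rfl
    have hu't₁ : (u' : ℝ) ≤ t₁ := NNReal.coe_le_coe.2 hu'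
    have h := abs_sub_lt_iff.1 (abs_sub_lt_of_witness hinj (hu't₁.trans ht₁T) hMT hd hdM
      (dist_self (X t₁)).le (by linarith : ε + 2 * ε + 0 < μ))
    linarith [h.1, h.2]
  have ht₁t'' : t₁ < t := by
    refine lt_of_le_of_ne ht₁t fun heq ↦ ?_
    rw [heq] at hdM
    have h := abs_sub_lt_iff.1 (abs_sub_lt_of_witness hinj hMT hut hdM hXt (dist_self (X t)).le
      (by linarith : 2 * ε + 2 * ε + 0 < μ))
    linarith [h.1, h.2]
  -- (2) OVERSHOOT: minimise the time over points after `t` with a witness at level `≥ M + θ`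
  have hu₀nn : 0 ≤ (M : ℝ) + θ + 2 * w := by positivity
  set u₀ : ℝ≥0 := ⟨(M : ℝ) + θ + 2 * w, hu₀nn⟩ with hu₀def
  have hu₀ : (u₀ : ℝ) = M + θ + 2 * w := rfl
  have hu₀T : (u₀ : ℝ) ≤ T + 1 := by rw [hu₀]; linarith
  obtain ⟨s'', hs''u₀, hd''⟩ := exists_bwd_witness hX hr (hsh u₀ hu₀T) le_rfl
  have hs''u₀' : (s'' : ℝ) ≤ M + θ + 2 * w := hu₀ ▸ NNReal.coe_le_coe.2 hs''u₀
  have hts'' : t ≤ s'' := by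
    by_contra h
    have h' := NNReal.coe_le_coe.2 (hrec s'' u₀ (not_le.1 h).le hu₀T (hd''.trans (by linarith)))
    rw [hu₀] at h'
    linarith
  set K₂ : Set (ℝ≥0 × ℝ≥0) := {p | t ≤ p.1 ∧ (p.1 : ℝ) ≤ T + 1 ∧ (M : ℝ) + θ ≤ p.2 ∧
    (p.2 : ℝ) ≤ T + 1 ∧ dist (X p.1) (r p.2) ≤ 2 * ε} with hK₂
  have hK₂c : IsCompact K₂ := by
    refine ((isCompact_Icc (a := (0 : ℝ≥0)) (b := T + 1)).prod
      (isCompact_Icc (a := (0 : ℝ≥0)) (b := T + 1))).of_isClosed_subset ?_ ?_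
    · exact (isClosed_le continuous_const continuous_fst).inter
        ((isClosed_le (continuous_subtype_val.comp continuous_fst) continuous_const).inter
        ((isClosed_le continuous_const (continuous_subtype_val.comp continuous_snd)).inter
        ((isClosed_le (continuous_subtype_val.comp continuous_snd) continuous_const).inter
        (isClosed_le ((hX.comp continuous_fst).dist (hr.comp continuous_snd))
          continuous_const))))
    · rintro ⟨a, b⟩ ⟨-, ha, -, hb, -⟩
      exact ⟨⟨zero_le, by exact_mod_cast ha⟩, zero_le, by exact_mod_cast hb⟩
  have hmem : (s'', u₀) ∈ K₂ :=
    ⟨hts'', hs''u₀'.trans (by linarith), by rw [hu₀]; linarith, hu₀T, hd''.trans (by linarith)⟩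
  obtain ⟨⟨t₂, u₂⟩, ⟨htt₂, ht₂T, hMu₂, hu₂T, hd₂⟩, hmin⟩ :=
    hK₂c.exists_isMinOn ⟨_, hmem⟩ continuous_fst.continuousOn
  have ht₂u₀ : (t₂ : ℝ) ≤ M + θ + 2 * w :=
    (NNReal.coe_le_coe.2 (isMinOn_iff.1 hmin (s'', u₀) hmem)).trans hs''u₀'
  have hu₂t₂ : (u₂ : ℝ) < t₂ + w := by
    obtain ⟨u'', hu'', hd⟩ := exists_fwd_witness hX hr (hsh t₂ ht₂T) le_rfl
    have hu''t₂ : (u'' : ℝ) ≤ t₂ := NNReal.coe_le_coe.2 hu''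
    have h := abs_sub_lt_iff.1 (abs_sub_lt_of_witness hinj (hu''t₂.trans ht₂T) hu₂T hd hd₂
      (dist_self (X t₂)).le (by linarith : ε + 2 * ε + 0 < μ))
    linarith [h.1, h.2]
  exact ⟨t₁, M, t₂, u₂, ht₁t'', htt₂, ht₁M, hMt₁, ht₂u₀, hMc₀, hMu₂, hu₂t₂, hu₂T, hd₂⟩

/-- A ball about a point of `closure E` staying `d`-away from `frontier E` lies in the open set
`E`. [folklore] -/
theorem ball_subset_of_le_infDist_frontier {E : Set ℂ} (hE : IsOpen E) {x : ℂ}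
    (hx : x ∈ closure E) {d : ℝ} (hd : 0 < d) (h : d ≤ infDist x (frontier E)) :
    ball x d ⊆ E := by
  have hmiss : ∀ y ∈ ball x d, y ∉ frontier E := fun y hy hyf ↦ by
    have h' : infDist x (frontier E) ≤ dist x y := infDist_le_dist_of_mem hyf
    rw [mem_ball, dist_comm] at hy
    linarith
  have hint : ∀ y ∈ ball x d, y ∈ closure E → y ∈ E := fun y hy hyc ↦ by
    have h' : y ∈ closure E \ frontier E := ⟨hyc, hmiss y hy⟩
    rwa [closure_sdiff_frontier, hE.interior_eq] at h'
  refine (convex_ball x d).isPreconnected.subset_left_of_subset_union (v := (closure E)ᶜ) hE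
    isClosed_closure.isOpen_compl (disjoint_compl_right.mono_left subset_closure)
    (fun y hy ↦ ?_) ⟨x, mem_ball_self hd, hint x (mem_ball_self hd) hx⟩
  by_cases hyc : y ∈ closure E
  · exact Or.inl (hint y hy hyc)
  · exact Or.inr hyc

/-- Membership in the tube (open `δ`-thickening of the arc of `r` over the real time window
`[a, b]`). [folklore] -/
theorem mem_tube_iff {r : ℝ≥0 → ℂ} {a b δ : ℝ} {x : ℂ} :
    x ∈ thickening δ (r '' {u : ℝ≥0 | a ≤ (u : ℝ) ∧ (u : ℝ) ≤ b}) ↔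
      ∃ u : ℝ≥0, a ≤ (u : ℝ) ∧ (u : ℝ) ≤ b ∧ dist x (r u) < δ := by
  simp only [mem_thickening_iff, exists_mem_image, mem_setOf_eq, and_assoc]

/-- The tube is preconnected (thickening of the continuous image of an interval). [folklore] -/
theorem isPreconnected_tube {r : ℝ≥0 → ℂ} (hr : Continuous r) {a b δ : ℝ} (hδ : 0 < δ) :
    IsPreconnected (thickening δ (r '' {u : ℝ≥0 | a ≤ (u : ℝ) ∧ (u : ℝ) ≤ b})) := by
  have hIo : OrdConnected {u : ℝ≥0 | a ≤ (u : ℝ) ∧ (u : ℝ) ≤ b} := ⟨fun x hx y hy z hz ↦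
    ⟨hx.1.trans (NNReal.coe_le_coe.2 hz.1), (NNReal.coe_le_coe.2 hz.2).trans hy.2⟩⟩
  exact isPreconnected_thickening (hIo.isPreconnected.image r hr.continuousOn) hδ

/-- **Gate alternative.** If a preconnected set inside `P ∪ Q ∪ C` meets `P` and `Q`, and
preconnected subsets of `P ∪ Q` lie on one side, then the set meets `C`. [folklore] -/
theorem exists_mem_inter_of_meets {C P Q G : Set ℂ}
    (hsides : ∀ S : Set ℂ, IsPreconnected S → S ⊆ P ∪ Q → S ⊆ P ∨ S ⊆ Q) (hPQ : Disjoint P Q)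
    (hG : IsPreconnected G) (hGsub : G ⊆ P ∪ Q ∪ C) {p q : ℂ} (hpG : p ∈ G) (hpP : p ∈ P)
    (hqG : q ∈ G) (hqQ : q ∈ Q) : ∃ c ∈ C, c ∈ G := by
  by_contra h
  push Not at h
  have hGPQ : G ⊆ P ∪ Q := fun x hx ↦ (hGsub hx).elim id fun hxC ↦ (h x hxC hx).elim
  rcases hsides G hG hGPQ with hGP | hGQ
  · exact Set.disjoint_left.1 hPQ (hGP hqG) hqQ
  · exact Set.disjoint_left.1 hPQ hpP (hGQ hpG)

/-- **Pocket** (Lawler's Lemma 4.13 on the shifted chain): for a simple trace and `t₁ < s ≤ t₂`,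
`ζ s ∈ H_{t₁}` and `g_{t₁}(ζ s)` lies within `ρ₁ + 4√(t₂ - t₁)` of `U t₁`, where `ρ₁` bounds the
driver oscillation on `[t₁, t₂]`. [folklore] -/
theorem dist_map_le_of_osc {U : ℝ≥0 → ℝ} {ζ : ℝ≥0 → ℂ} (hU : Continuous U)
    (hgen : IsGeneratedByCurve U ζ) (hs : IsSimpleTrace ζ) {t₁ t₂ s : ℝ≥0} (h₁ : t₁ < s)
    (h₂ : s ≤ t₂) {ρ₁ : ℝ} (hosc : ∀ v : ℝ≥0, t₁ ≤ v → v ≤ t₂ → |U v - U t₁| ≤ ρ₁) :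
    ζ s ∈ domain U t₁ ∧ dist (map U t₁ (ζ s)) (U t₁) ≤ ρ₁ + 4 * Real.sqrt ((t₂ : ℝ) - t₁) := by
  have h12 : t₁ ≤ t₂ := h₁.le.trans h₂
  have hdom : ζ s ∈ domain U t₁ := by
    refine ⟨hs.2 s (lt_of_le_of_lt zero_le h₁), fun hmem ↦ ?_⟩
    rw [hgen.hull_eq_image hs] at hmem
    obtain ⟨s', hs', heq⟩ := hmem
    rw [hs.1 heq] at hs'
    exact absurd hs'.2 (not_le.2 h₁)
  refine ⟨hdom, ?_⟩
  have hmem₂ : ζ s ∈ hull U t₂ := by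
    rw [hgen.hull_eq_image hs]
    exact ⟨s, ⟨lt_of_le_of_lt zero_le h₁, h₂⟩, rfl⟩
  have hW : Continuous fun u : ℝ≥0 ↦ U (t₁ + u) := hU.comp (continuous_const.add continuous_id)
  have hS : ∀ v : ℝ≥0, v ≤ t₂ - t₁ →
      |(fun u : ℝ≥0 ↦ U (t₁ + u)) v - (fun u : ℝ≥0 ↦ U (t₁ + u)) 0| ≤ ρ₁ := fun v hv ↦ by
    simp only [add_zero]
    exact hosc (t₁ + v) le_self_add ((le_tsub_iff_left h12).1 hv)
  have h := hull_subset_closedBall_driving hW hS ((mem_hull_iff_map_mem_hull hU hdom h12).1 hmem₂)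
  simp only [add_zero, mem_closedBall] at h
  rwa [NNReal.coe_sub h12] at h

/-- The dictionary: for `z ∈ H_{t₁}`, `ψ (f_{t₁} (g_{t₁} z)) = ψ̄ z`. [folklore] -/
theorem apply_loewnerInv_map {E : DobrushinDomain} (ψ : ConformalEquiv upperHalfPlaneSet E.carrier)
    {U : ℝ≥0 → ℝ} (hU : Continuous U) {t₁ : ℝ≥0} {z : ℂ} (hz : z ∈ domain U t₁) :
    ψ (loewnerInv U t₁ (map U t₁ z)) = ψ.boundaryExtension z := by
  rw [loewnerInv_map hU hz, ψ.boundaryExtension_eq (domain_subset U t₁ hz)]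

/-- A point of `E` off `ψ (H_{t₁})` lies on the past `ψ̄ (ζ (0, t₁])` (simple trace:
`K_{t₁} = ζ (0, t₁]`). [folklore] -/
theorem exists_eq_of_not_mem_image_domain {E : DobrushinDomain}
    (ψ : ConformalEquiv upperHalfPlaneSet E.carrier) {U : ℝ≥0 → ℝ} {ζ : ℝ≥0 → ℂ}
    (hgen : IsGeneratedByCurve U ζ) (hs : IsSimpleTrace ζ) {t₁ : ℝ≥0} {x : ℂ}
    (hx : x ∈ E.carrier) (hx' : x ∉ ψ '' domain U t₁) :
    ∃ s : ℝ≥0, 0 < s ∧ s ≤ t₁ ∧ ψ.boundaryExtension (ζ s) = x := by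
  obtain ⟨z, hz, rfl⟩ := ψ.bijOn.surjOn hx
  have hzK : z ∈ hull U t₁ := by
    by_contra h
    exact hx' ⟨z, ⟨hz, h⟩, rfl⟩
  rw [hgen.hull_eq_image hs] at hzK
  obtain ⟨s, hs', rfl⟩ := hzK
  exact ⟨s, hs'.1, hs'.2, ψ.boundaryExtension_eq hz⟩

end PathUpgradeRFlank

open PathUpgradeRFlank in
/-- **The Flank Lemma** (deterministic heart of the ORDER half of crux `PathUpgradeR`): a
`c₀`-sub-front point `ψ̄ (ζ t)` of a Loewner chain with simple trace, `ε`-shadowed by a regular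
reference curve, with small driver oscillation on short capacity windows and a gate decomposition
at its record time, is flanked by its past along every short segment towards a conformally far
point `e`: `∃ s < t, ψ̄ (ζ s) ∈ segment ℝ (ψ̄ (ζ t)) e`. [folklore] -/
theorem stub_flank : ∀ (E : Literature.Probability.RandomPlanarGeometry.DobrushinDomain) (ψ : Literature.Probability.RandomPlanarGeometry.ConformalEquiv UpperHalfPlane.upperHalfPlaneSet E.carrier), E.IsChordalUniformizing ψ → ∀ (U : NNReal → ℝ) (ζ ρ : NNReal → ℂ), Continuous U → Literature.Probability.RandomPlanarGeometry.Loewner.IsGeneratedByCurve U ζ → Literature.Probability.RandomPlanarGeometry.Loewner.IsSimpleTrace ζ → Continuous ρ → (∀ u, 0 ≤ (ρ u).im) → ∀ (T : NNReal) (ε μ μ₀ w θ c₀ ρ₁ m₁ h₀ d' dS lam r₁ Rout α₀ dB : ℝ), 0 < ε → 5 * ε < μ → 0 < w → w < θ / 2 → 8 * θ < c₀ → 5 * θ + w ≤ 1 → 0 ≤ ρ₁ → 0 < r₁ → 5 * (ρ₁ + Real.sqrt (θ + 4 * w)) ≤ r₁ → 0 < Rout → Rout ≤ m₁ → Rout ≤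 h₀ → 0 ≤ dS → lam + 5 * ε + 2 * dS < μ₀ → 3 * ε < dB → 2 * dS + 2 * ε < dB → 0 < α₀ → (∀ t : NNReal, (t : ℝ) ≤ T + 1 → Metric.hausdorffDist (ψ.boundaryExtension '' (ζ '' Set.Icc 0 t)) ((fun u => ψ.boundaryExtension (ρ u)) '' Set.Icc 0 t) ≤ ε) → (∀ s t : NNReal, (s : ℝ) ≤ T + 1 → (t : ℝ) ≤ T + 1 → w ≤ |(s : ℝ) - t| → μ ≤ dist (ψ.boundaryExtension (ρ s)) (ψ.boundaryExtension (ρ t))) → (∀ s t : NNReal, (s : ℝ) ≤ T + 1 → (t : ℝ) ≤ T + 1 → c₀ / 4 ≤ |(s : ℝ) - t| → μ₀ ≤ dist (ψ.boundaryExtension (ρ s)) (ψ.boundaryExtension (ρ t))) → (∀ s s' : NNReal, (s : ℝ) ≤ T + 1 → (s' : ℝ) ≤ T + 1 → |(s : ℝ) - s'| ≤ θ + 4 * w → |U s - U s'| ≤ ρ₁) → (∀ t₁ : NNReal, (t₁ : ℝ) ≤ T → ∃ u : NNReal, (t₁ : ℝ) + 2 * θ ≤ u ∧ (u : ℝ)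 ≤ t₁ + 4 * θ ∧ ρ u ∈ Literature.Probability.RandomPlanarGeometry.Loewner.domain U t₁ ∧ m₁ ≤ ‖Literature.Probability.RandomPlanarGeometry.Loewner.map U t₁ (ρ u) - U t₁‖) → (∀ t₁ : NNReal, (t₁ : ℝ) ≤ T → ∀ e ∈ E.carrier, d' ≤ Metric.infDist e ((fun u => ψ.boundaryExtension (ρ u)) '' Set.Icc 0 (T + 1) ∪ frontier E.carrier) → ψ.symm e ∈ Literature.Probability.RandomPlanarGeometry.Loewner.domain U t₁ ∧ h₀ ≤ (Literature.Probability.RandomPlanarGeometry.Loewner.map U t₁ (ψ.symm e)).im) → (∀ u : NNReal, α₀ / 2 ≤ (u : ℝ) → (u : ℝ) ≤ T + 1 → dB ≤ Metric.infDist (ψ.boundaryExtension (ρ u)) (frontier E.carrier)) → (∀ t₁ : NNReal, (t₁ : ℝ) ≤ T → ∃ C P Q : Set ℂ, (∀ p ∈ C, ∀ q ∈ C, dist p q ≤ lam) ∧ Disjoint P Q ∧ Disjoint P C ∧ Disjoint Q C ∧ P ∪ Q ∪ C = ψ '' (Literature.Probability.RandomPlanarGeometry.Loewner.domain U t₁)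 ∧ (∀ S : Set ℂ, IsPreconnected S → S ⊆ P ∪ Q → S ⊆ P ∨ S ⊆ Q) ∧ (∀ y : ℂ, 0 < y.im → dist y (U t₁) ≤ r₁ → ψ (Literature.Probability.RandomPlanarGeometry.Loewner.loewnerInv U t₁ y) ∈ P) ∧ (∀ y : ℂ, 0 < y.im → Rout ≤ dist y (U t₁) → ψ (Literature.Probability.RandomPlanarGeometry.Loewner.loewnerInv U t₁ y) ∈ Q)) → ∀ t : NNReal, (t : ℝ) ≤ T → ∀ ut : NNReal, α₀ ≤ (ut : ℝ) → (ut : ℝ) ≤ T + 1 → dist (ψ.boundaryExtension (ζ t)) (ψ.boundaryExtension (ρ ut)) ≤ 2 * ε → (∃ s : NNReal, s ≤ t ∧ ∃ us : NNReal, (us : ℝ) ≤ T + 1 ∧ dist (ψ.boundaryExtension (ζ s)) (ψ.boundaryExtension (ρ us)) ≤ 2 * ε ∧ (ut : ℝ) + c₀ ≤ us) → ∀ e ∈ E.carrier, dist e (ψ.boundaryExtension (ζ t)) ≤ 2 * dS → d' ≤ Metric.infDist e ((fun u => ψ.boundaryExtension (ρ u)) '' Set.Icc 0 (T + 1) ∪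 frontier E.carrier) → ∃ s : NNReal, s < t ∧ ψ.boundaryExtension (ζ s) ∈ segment ℝ (ψ.boundaryExtension (ζ t)) e := by
  intro E ψ _ U ζ ρ hU hgen hsim hρ hρim T ε μ μ₀ w θ c₀ ρ₁ m₁ h₀ d' dS lam r₁ Rout α₀ dB hε hεμ hw
    hwθ hθc hθ1 hρ₁ _ hr₁ _ hRm₁ hRh₀ hdS hμ₀ hdB3 hdB2 _ hsh hinj hinj₀ hosc hMa hMb hbd hgate t
    ht ut hαut hutT hXt hsub e he hedS hed'
  -- continuity of `X = ψ̄ ∘ ζ` and `r = ψ̄ ∘ ρ`; `r` takes values in `closure E`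
  have hcont := continuousOn_boundaryExtension_im_nonneg ψ
  have hXc : Continuous fun s ↦ ψ.boundaryExtension (ζ s) :=
    hcont.comp_continuous hgen.continuous fun s ↦ hgen.im_nonneg s
  have hrc : Continuous fun u ↦ ψ.boundaryExtension (ρ u) := hcont.comp_continuous hρ hρim
  have hrclos : ∀ u, ψ.boundaryExtension (ρ u) ∈ closure E.carrier := fun u ↦
    JordanDomain.mapsTo_boundaryExtension_holds E.toJordanDomain ψ
      (mem_closure_upperHalfPlaneSet_iff.2 (hρim u))
  have hsh' : ∀ t' : ℝ≥0, (t' : ℝ) ≤ T + 1 →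
      hausdorffDist ((fun s ↦ ψ.boundaryExtension (ζ s)) '' Icc 0 t')
        ((fun u ↦ ψ.boundaryExtension (ρ u)) '' Icc 0 t') ≤ ε := fun t' ht' ↦ by
    have h := hsh t' ht'
    rwa [image_image] at h
  have hθ : 0 < θ := by linarith
  -- (1), (2): record time `t₁`, record level `M`, overshoot time `t₂` with witness `u₂`
  obtain ⟨t₁, M, t₂, u₂, ht₁t, htt₂, ht₁M, hMt₁, ht₂M, hMc₀, hMu₂, hu₂t₂, hu₂T, hd₂⟩ :=
    exists_record_overshoot hXc hrc hε hεμ hw hwθ hθc hθ1 hsh' hinj ht hutT hXt hsub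
  have ht₁t' : (t₁ : ℝ) < t := NNReal.coe_lt_coe.2 ht₁t
  have htt₂' : (t : ℝ) ≤ t₂ := NNReal.coe_le_coe.2 htt₂
  have ht₁T : (t₁ : ℝ) ≤ T := by linarith
  have ht₁T1 : (t₁ : ℝ) ≤ T + 1 := by linarith
  -- (3) the gate at `t₁` and the pocket `X (t₁, t₂] ⊆ P`
  obtain ⟨C, P, Q, hClam, hPQ, -, -, hPQC, hsides, hP, hQ⟩ := hgate t₁ ht₁T
  have hpocket : ∀ s : ℝ≥0, t₁ < s → s ≤ t₂ → ψ.boundaryExtension (ζ s) ∈ P := by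
    intro s h1 h2
    have hosc' : ∀ v : ℝ≥0, t₁ ≤ v → v ≤ t₂ → |U v - U t₁| ≤ ρ₁ := fun v hv1 hv2 ↦ by
      have hv1' : (t₁ : ℝ) ≤ v := NNReal.coe_le_coe.2 hv1
      have hv2' : (v : ℝ) ≤ t₂ := NNReal.coe_le_coe.2 hv2
      refine hosc v t₁ (by linarith) ht₁T1 ?_
      rw [abs_of_nonneg (by linarith)]
      linarith
    obtain ⟨hdom, hdist⟩ := dist_map_le_of_osc hU hgen hsim h1 h2 hosc'
    have hnear : dist (map U t₁ (ζ s)) (U t₁) ≤ r₁ := by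
      refine hdist.trans (le_trans ?_ hr₁)
      have hsq : Real.sqrt ((t₂ : ℝ) - t₁) ≤ Real.sqrt (θ + 4 * w) :=
        Real.sqrt_le_sqrt (by linarith)
      linarith [Real.sqrt_nonneg (θ + 4 * w)]
    have h := hP _ (im_map_pos hU hdom) hnear
    rwa [apply_loewnerInv_map ψ hU hdom] at h
  -- (4) the tube `G` about `r [M + θ/2, M + 5θ]`: misses the past, meets `P` and `Q`, hence `C`
  set G : Set ℂ := thickening (3 * ε) ((fun u ↦ ψ.boundaryExtension (ρ u)) ''
    {u : ℝ≥0 | (M : ℝ) + θ / 2 ≤ (u : ℝ) ∧ (u : ℝ) ≤ M + 5 * θ}) with hG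
  have hGpast : ∀ s : ℝ≥0, s ≤ t₁ → ψ.boundaryExtension (ζ s) ∉ G := fun s hs hsG ↦ by
    obtain ⟨u, hu1, hu2, hd⟩ := mem_tube_iff.1 hsG
    obtain ⟨u', hu', hd'⟩ := exists_fwd_witness hXc hrc (hsh' t₁ ht₁T1) hs
    have hu't₁ : (u' : ℝ) ≤ t₁ := NNReal.coe_le_coe.2 hu'
    have h := abs_sub_lt_iff.1 (abs_sub_lt_of_witness hinj (by linarith) (by linarith) hd.le hd'
      (dist_self _).le (by linarith : 3 * ε + ε + 0 < μ))
    linarith [h.1, h.2]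
  have hX₂G : ψ.boundaryExtension (ζ t₂) ∈ G :=
    mem_tube_iff.2 ⟨u₂, by linarith, by linarith, hd₂.trans_lt (by linarith)⟩
  obtain ⟨uq, huq1, huq2, hρdom, hm₁⟩ := hMa t₁ ht₁T
  have hqG : ψ.boundaryExtension (ρ uq) ∈ G :=
    mem_tube_iff.2 ⟨uq, by linarith, by linarith, by rw [dist_self]; linarith⟩
  have hqQ : ψ.boundaryExtension (ρ uq) ∈ Q := by
    have h := hQ _ (im_map_pos hU hρdom) (by rw [dist_eq_norm]; exact hRm₁.trans hm₁)
    rwa [apply_loewnerInv_map ψ hU hρdom] at h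
  have hGsub : G ⊆ P ∪ Q ∪ C := fun x hx ↦ by
    obtain ⟨u, hu1, hu2, hd⟩ := mem_tube_iff.1 hx
    have hxE : x ∈ E.carrier :=
      ball_subset_of_le_infDist_frontier E.isOpen (hrclos u) (by linarith)
        (hbd u (by linarith) (by linarith)) (mem_ball.2 (hd.trans (by linarith)))
    rw [hPQC]
    by_contra hx'
    obtain ⟨s, -, hst₁, rfl⟩ := exists_eq_of_not_mem_image_domain ψ hgen hsim hxE hx'
    exact hGpast s hst₁ hx
  obtain ⟨cstar, hcC, hcG⟩ := exists_mem_inter_of_meets hsides hPQ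
    (isPreconnected_tube hrc (by linarith)) hGsub hX₂G (hpocket t₂ (ht₁t.trans_le htt₂) le_rfl)
    hqG hqQ
  obtain ⟨uc, huc1, huc2, hdc⟩ := mem_tube_iff.1 hcG
  -- (5) the transversal segment `S` from `X t ∈ P` to `e ∈ Q`: in `E`, misses `C`
  set S : Set ℂ := segment ℝ (ψ.boundaryExtension (ζ t)) e with hS
  have hSball : S ⊆ closedBall (ψ.boundaryExtension (ρ ut)) (2 * dS + 2 * ε) := by
    refine (convex_closedBall _ _).segment_subset ?_ ?_
    · rw [mem_closedBall]
      linarith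
    · rw [mem_closedBall]
      linarith [dist_triangle e (ψ.boundaryExtension (ζ t)) (ψ.boundaryExtension (ρ ut))]
  have hSE : S ⊆ E.carrier := fun x hx ↦
    ball_subset_of_le_infDist_frontier E.isOpen (hrclos ut) (by linarith)
      (hbd ut (by linarith) hutT) (mem_ball.2 ((mem_closedBall.1 (hSball hx)).trans_lt hdB2))
  have hSC : ∀ x ∈ S, x ∉ C := fun x hx hxC ↦ by
    have h1 : dist x cstar ≤ lam := hClam x hxC cstar hcC
    have h2 := mem_closedBall.1 (hSball hx)
    have h3 : μ₀ ≤ dist (ψ.boundaryExtension (ρ uc)) (ψ.boundaryExtension (ρ ut)) :=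
      hinj₀ uc ut (by linarith) hutT (by rw [abs_of_nonneg (by linarith)]; linarith)
    linarith [dist_triangle4 (ψ.boundaryExtension (ρ uc)) cstar x (ψ.boundaryExtension (ρ ut)),
      dist_comm cstar (ψ.boundaryExtension (ρ uc)), dist_comm x cstar]
  have heQ : e ∈ Q := by
    obtain ⟨hzdom, hh₀⟩ := hMb t₁ ht₁T e he hed'
    have hfar : Rout ≤ dist (map U t₁ (ψ.symm e)) (U t₁) := by
      refine (hRh₀.trans hh₀).trans ?_
      rw [dist_eq_norm]
      simpa using Complex.im_le_norm (map U t₁ (ψ.symm e) - U t₁)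
    have h := hQ _ (im_map_pos hU hzdom) hfar
    rwa [loewnerInv_map hU hzdom, ψ.apply_symm_apply he] at h
  have hnot : ¬ S ⊆ P ∪ Q ∪ C := fun hsub' ↦ by
    obtain ⟨c, hcC', hcS⟩ := exists_mem_inter_of_meets hsides hPQ
      (convex_segment _ _).isPreconnected hsub' (left_mem_segment ℝ _ _)
      (hpocket t ht₁t htt₂) (right_mem_segment ℝ _ _) heQ
    exact hSC c hcS hcC'
  obtain ⟨p, hpS, hp⟩ := not_subset.1 hnot
  rw [hPQC] at hp
  obtain ⟨s, -, hst₁, hps⟩ := exists_eq_of_not_mem_image_domain ψ hgen hsim (hSE hpS) hp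
  exact ⟨s, lt_of_le_of_lt hst₁ ht₁t, hps ▸ hpS⟩

end Summit.CriticalPhenomena.SAWScalingLimit.Theorems
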